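import Literature.Claims.NS.Chaabani2020
import Literature.Analysis.FunctionSpaces.TorusAgmonExplicit
import Literature.Analysis.FunctionSpaces.TorusVectorParseval
import Literature.Analysis.FunctionSpaces.TorusFourierSynthesis
import Mathlib.Algebra.Order.Chebyshev
import Mathlib.Data.Pi.Interval
import HarnessLib

/-!
# Solo salvage for claim C22 `Chaabani2020`, part 4: the Wiener-norm control in case (2.3) (towards Step 4)

Continuation of `Theorems/SoloSalvageChaabani2020*.lean` (seat `ns-claims-salvage-p2`). Step 4 (case (2.3),
l.216–228 p.5–6) rests on one observation: when `F_m(u) = Σ_{|k|≤m}|û(k)| − Σ_{|k|>m}|û(k)| ≥ 0`, the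
Wiener norm `Σ_k |û(k)|` — hence `‖u‖_∞` — is at most twice the LOW-mode sum, which Cauchy–Schwarz and
Parseval bound by `√(#{|k|≤m}) ‖u‖_{L²}` («Σ_{|k|≤m}|û| ≤ (Σ_{|k|≤m}1)^{1/2}‖u‖», l.220–224). This file
proves exactly that, over the typed vocabulary (`splitF`, `lowSum`, `highSum`, `countLow`, `absCoeff`):

* `lowSet_finite` — `{k ∈ ℤ³ : |k|² ≤ m²}` is finite; `countLow_eq_card`, `lowSum_eq_sum`;
* `lowSum_le_sqrt_countLow_mul` — `Σ_{|k|≤m}|v̂(k)| ≤ √(countLow m) · √(∫‖v‖²)`;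
* `norm_le_two_mul_lowSum` — `F_m(v) ≥ 0 ⇒ ‖v(x)‖ ≤ 2 Σ_{|k|≤m}|v̂(k)|` (Fourier inversion bound
  `Torus.norm_le_tsum_norm_mFourierCoeff`);
* `norm_le_of_splitF_nonneg` — the combination `‖v(x)‖ ≤ 2 √(countLow m) √(∫‖v‖²)`.

The remaining part of Step 4 (H¹ balance + Young + Grönwall with this sup bound and the energy decay) is
not assembled here. Solo lane.

WHAT THIS IS NOT: not a claim about NS regularity or blow-up; not a claim about any author beyond the
typed locator.
-/

noncomputable section

open Set MeasureTheory Finset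
open scoped ENNReal

-- The mandated landing namespace repeats the summit name by design (D-0017).
set_option linter.dupNamespace false

namespace Summit.NavierStokesRegularity.NavierStokesRegularity.Theorems

namespace Chaabani2020

open Literature.Claims.NS.Chaabani2020 Literature.Analysis Literature.Analysis.FunctionSpaces

/-- The low-mode index set `{k ∈ ℤ³ : Σ kᵢ² ≤ m²}` is finite (inside the box `|kᵢ| ≤ ⌈|m|⌉`). [folklore] -/
theorem lowSet_finite (m : ℝ) : ({k : Fin 3 → ℤ | kNormSq k ≤ m ^ 2} : Set (Fin 3 → ℤ)).Finite := by
  set N : ℤ := ⌈|m|⌉ with hN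
  refine (Set.finite_Icc (fun _ : Fin 3 => -N) (fun _ : Fin 3 => N)).subset ?_
  intro k hk
  have hk' : kNormSq k ≤ m ^ 2 := hk
  have hcomp : ∀ i : Fin 3, ((k i : ℤ) : ℝ) ^ 2 ≤ m ^ 2 := by
    intro i
    refine le_trans ?_ hk'
    unfold kNormSq
    exact Finset.single_le_sum (f := fun j => ((k j : ℤ) : ℝ) ^ 2) (fun j _ => sq_nonneg _)
      (Finset.mem_univ i)
  have habs : ∀ i : Fin 3, |((k i : ℤ) : ℝ)| ≤ |m| := fun i => sq_le_sq.1 (by simpa using hcomp i)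
  have hNm : |m| ≤ (N : ℝ) := by rw [hN]; exact Int.le_ceil _
  refine ⟨fun i => ?_, fun i => ?_⟩
  · have h := (abs_le.1 ((habs i).trans hNm)).1
    exact_mod_cast h
  · have h := (abs_le.1 ((habs i).trans hNm)).2
    exact_mod_cast h

/-- `countLow m = #{k : |k|² ≤ m²}` (the `tsum` of the indicator is the cardinality). [folklore] -/
theorem countLow_eq_card (m : ℝ) : countLow m = ((lowSet_finite m).toFinset.card : ℝ) := by
  unfold countLow
  rw [tsum_eq_sum (s := (lowSet_finite m).toFinset) (fun k hk => by
    rw [Set.indicator_of_notMem]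
    rwa [Set.Finite.mem_toFinset] at hk)]
  rw [Finset.sum_congr rfl (fun k hk => Set.indicator_of_mem ((Set.Finite.mem_toFinset _).1 hk) _)]
  simp

/-- `lowSum m v` as a finite sum over the low-mode set. [folklore] -/
theorem lowSum_eq_sum (m : ℝ) (v : UnitAddTorus (Fin 3) → EuclideanSpace ℝ (Fin 3)) :
    lowSum m v = ∑ k ∈ (lowSet_finite m).toFinset, absCoeff v k := by
  unfold lowSum
  rw [tsum_eq_sum (s := (lowSet_finite m).toFinset) (fun k hk => by
    rw [Set.indicator_of_notMem]
    rwa [Set.Finite.mem_toFinset] at hk)]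
  exact Finset.sum_congr rfl (fun k hk => Set.indicator_of_mem ((Set.Finite.mem_toFinset _).1 hk) _)

/-- **Cauchy–Schwarz + Parseval on the low modes** (l.220–224): `Σ_{|k|≤m}|v̂(k)| ≤ √(countLow m)·√(∫‖v‖²)`
for `v ∈ L²(𝕋³)`. [cite: Chaabani2020, §2 l.220–224 p.5–6] -/
theorem lowSum_le_sqrt_countLow_mul {m : ℝ} {v : UnitAddTorus (Fin 3) → EuclideanSpace ℝ (Fin 3)}
    (hv : MemLp v 2 volume) :
    lowSum m v ≤ Real.sqrt (countLow m) * Real.sqrt (∫ x, ‖v x‖ ^ 2 ∂volume) := by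
  set T := (lowSet_finite m).toFinset with hT
  rw [lowSum_eq_sum, countLow_eq_card, ← hT]
  have h0 : ∀ k, 0 ≤ absCoeff v k := fun k => norm_nonneg _
  -- Cauchy–Schwarz on the finite set
  have hCS : (∑ k ∈ T, absCoeff v k) ^ 2 ≤ (T.card : ℝ) * ∑ k ∈ T, absCoeff v k ^ 2 :=
    sq_sum_le_card_mul_sum_sq
  -- Parseval: the partial sum of squares is at most `∫‖v‖²`
  have hpar : HasSum (fun k : Fin 3 → ℤ => absCoeff v k ^ 2) (∫ x, ‖v x‖ ^ 2 ∂volume) :=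
    Torus.hasSum_sq_norm_mFourierCoeff_complexify hv
  have hle : ∑ k ∈ T, absCoeff v k ^ 2 ≤ ∫ x, ‖v x‖ ^ 2 ∂volume := by
    rw [← hpar.tsum_eq]
    exact hpar.summable.sum_le_tsum T (fun k _ => sq_nonneg _)
  have hsum0 : 0 ≤ ∑ k ∈ T, absCoeff v k := Finset.sum_nonneg fun k _ => h0 k
  have hI0 : 0 ≤ ∫ x, ‖v x‖ ^ 2 ∂volume := integral_nonneg fun x => sq_nonneg _
  calc ∑ k ∈ T, absCoeff v k = Real.sqrt ((∑ k ∈ T, absCoeff v k) ^ 2) := (Real.sqrt_sq hsum0).symm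
    _ ≤ Real.sqrt ((T.card : ℝ) * ∫ x, ‖v x‖ ^ 2 ∂volume) := by
        refine Real.sqrt_le_sqrt (hCS.trans ?_)
        exact mul_le_mul_of_nonneg_left hle (Nat.cast_nonneg _)
    _ = Real.sqrt (T.card : ℝ) * Real.sqrt (∫ x, ‖v x‖ ^ 2 ∂volume) :=
        Real.sqrt_mul (Nat.cast_nonneg _) _

/-- **`F_m ≥ 0` controls the Wiener norm by the low modes**: for smooth `v` with `splitF m v ≥ 0`,
`‖v(x)‖ ≤ Σ_k |v̂(k)| = lowSum + highSum ≤ 2 · lowSum`. [cite: Chaabani2020, §2 l.216–224 p.5–6] -/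
theorem norm_le_two_mul_lowSum {m : ℝ} {v : UnitAddTorus (Fin 3) → EuclideanSpace ℝ (Fin 3)}
    (hv : Torus.IsSmooth v) (hF : 0 ≤ splitF m v) (x : UnitAddTorus (Fin 3)) :
    ‖v x‖ ≤ 2 * lowSum m v := by
  have hsum : Summable (absCoeff v) := (hv.complexify_comp.rapidDecay_mFourierCoeff).summable_norm
  have hW : ‖v x‖ ≤ ∑' k, absCoeff v k := Torus.norm_le_tsum_norm_mFourierCoeff hv x
  -- split the Wiener sum into low and high modes
  set S : Set (Fin 3 → ℤ) := {k | kNormSq k ≤ m ^ 2} with hS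
  have hcompl : ({k : Fin 3 → ℤ | m ^ 2 < kNormSq k} : Set (Fin 3 → ℤ)) = Sᶜ := by
    ext k; simp [hS, not_le]
  have hsplit : ∑' k, absCoeff v k = lowSum m v + highSum m v := by
    unfold lowSum highSum
    rw [hcompl, ← (hsum.indicator S).tsum_add (hsum.indicator Sᶜ)]
    congr 1
    funext k
    exact (Set.indicator_self_add_compl_apply S (absCoeff v) k).symm
  have hhigh : highSum m v ≤ lowSum m v := by
    have : 0 ≤ lowSum m v - highSum m v := hF
    linarith
  linarith

/-- **The sup bound of case (2.3)**: for smooth `v` with `F_m(v) ≥ 0`,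
`‖v(x)‖ ≤ 2 √(countLow m) √(∫‖v‖²)` for all `x`. [cite: Chaabani2020, §2 l.216–224 p.5–6] -/
theorem norm_le_of_splitF_nonneg {m : ℝ} {v : UnitAddTorus (Fin 3) → EuclideanSpace ℝ (Fin 3)}
    (hv : Torus.IsSmooth v) (hF : 0 ≤ splitF m v) (x : UnitAddTorus (Fin 3)) :
    ‖v x‖ ≤ 2 * (Real.sqrt (countLow m) * Real.sqrt (∫ y, ‖v y‖ ^ 2 ∂volume)) :=
  (norm_le_two_mul_lowSum hv hF x).trans
    (mul_le_mul_of_nonneg_left (lowSum_le_sqrt_countLow_mul (hv.memLp 2)) (by norm_num))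

end Chaabani2020

end Summit.NavierStokesRegularity.NavierStokesRegularity.Theorems
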